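import Mathlib
import Literature.Analysis.Complex.PositiveHarmonicBoundaryPole
import Literature.Analysis.Complex.UnivalentSequenceLimits
import HarnessLib

/-!
# A three-point Harnack inequality on the right half-plane, and a function obeying both sharp
# chord laws that is not an infimum of non-negative harmonic functions

Topic `Literature/Analysis/Complex` (positive harmonic functions on the half-plane `H = {Re z > 0}`).

The sharp TWO-point Harnack inequalities of `H` along its normal ray are the chord laws
`v(x₁) ≥ (x₁/x₂) v(x₂)` and `v(x₂) ≥ (x₁/x₂) v(x₁)` for `0 < x₁ ≤ x₂` (tree:
`harnack_chord_halfPlane`, `mul_le_mul_of_harmonic_nonneg_halfPlane`); they are inherited by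
pointwise infima of families of non-negative harmonic functions.  The cone of non-negative harmonic
functions on `H` satisfies MORE: by the Herglotz–Riesz representation every such `v` is, on the
disc model, a Poisson integral of a positive boundary measure, so every linear inequality between
point values that holds for all Poisson kernels holds for all `v`.

* `three_point_harnack_halfPlane` — **`v(2) ≥ v(1)/4 + 7·v(9)/36`** for every `v ≥ 0` harmonic on
  `H` (equality for `v = Re z`).  Proof: Cayley pull-back `w = (z-1)/(z+1)` to the unit disc
  (`1, 2, 9 ↦ 0, 1/3, 4/5`), the tree's `exists_measure_eq_integral_poissonKernel`, and the rational
  kernel certificate `P(1/3, ζ) − P(0, ζ)/4 − 7 P(4/5, ζ)/36 ≥ 0` on the circle, where for real `r`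
  and `|ζ| = 1`, `P(r, ζ) = (1 − r²)/(1 − 2 r Re ζ + r²)` and the difference equals
  `16 (1 − c)(52 + 15 c) / (4 (10 − 6c)(41 − 40c))`, `c = Re ζ ∈ [−1, 1]`.
* `not_harnackHull_max_one_half` — the function `g(x) = max 1 (x/2)` on `[1, ∞)` has `g(x)/x`
  non-increasing and `x·g(x)` non-decreasing, yet it is NOT (even approximately, in the sense of
  `ε`-touching majorants) the trace of an infimum of non-negative harmonic functions on `H`:
  any harmonic majorant `G ≥ g` has `G(2) ≥ g(1)/4 + 7 g(9)/36 = 9/8 > 1 = g(2)`.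

Motivation (tree): stub (M) `stub_harnackConeMembership` of line `Sketch` for the crux
`EulerDescent.RayDescent` (Summits/QuantumFields/QCD) posits Harnack-cone membership of the lattice
gap along a mass ray; this file makes precise that such membership is strictly stronger than the two
chord laws (the statement was recorded with a paper proof as a near-miss in that crux's
`Disproof.lean`, 2026-08-17).  Everything here is classical and fully proved. [folklore]
-/

noncomputable section

namespace Literature.Analysis.Complex

open _root_.Complex Metric Set Filter MeasureTheory InnerProductSpace
open scoped Topology Real

/-! ### The Poisson kernel at real points of the disc -/

/-- For `|ζ| = 1` and real `r`: `|ζ − r|² = 1 − 2 r Re ζ + r²`. [folklore] -/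
theorem norm_sub_ofReal_sq_of_norm_eq_one {ζ : ℂ} (hζ : ‖ζ‖ = 1) (r : ℝ) :
    ‖ζ - (r : ℂ)‖ ^ 2 = 1 - 2 * r * ζ.re + r ^ 2 := by
  have h1 : ζ.re * ζ.re + ζ.im * ζ.im = 1 := by
    rw [← normSq_apply, ← Complex.sq_norm, hζ, one_pow]
  rw [Complex.sq_norm, normSq_apply]
  simp only [sub_re, ofReal_re, sub_im, ofReal_im, sub_zero]
  linear_combination h1

/-- The Poisson kernel of the unit disc at a REAL point `r` and a boundary point `ζ`:
`P(r, ζ) = (1 − r²)/(1 − 2 r Re ζ + r²)`. [folklore] -/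
theorem poissonKernel_zero_ofReal {ζ : ℂ} (hζ : ‖ζ‖ = 1) (r : ℝ) :
    poissonKernel 0 (r : ℂ) ζ = (1 - r ^ 2) / (1 - 2 * r * ζ.re + r ^ 2) := by
  rw [poissonKernel_zero_eq, hζ, norm_real, Real.norm_eq_abs, sq_abs, one_pow,
    norm_sub_ofReal_sq_of_norm_eq_one hζ r]

/-- The real part of a unit complex number lies in `[−1, 1]`. [folklore] -/
theorem abs_re_le_one_of_norm_eq_one {ζ : ℂ} (hζ : ‖ζ‖ = 1) : |ζ.re| ≤ 1 := by
  have := abs_re_le_norm ζ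
  rwa [hζ] at this

/-- **The rational kernel certificate**: for `c ∈ [−1, 1]`,
`P(0,c)/4 + 7 P(4/5,c)/36 ≤ P(1/3,c)` where `P(r,c) = (1 − r²)/(1 − 2rc + r²)`; after clearing
the positive denominators this is `16 (1 − c)(52 + 15c) ≥ 0`. [folklore] -/
theorem poisson_threePoint_certificate {c : ℝ} (hc₁ : c ≤ 1) (hc₂ : -1 ≤ c) :
    (1 : ℝ) / 4 * ((1 - (0 : ℝ) ^ 2) / (1 - 2 * 0 * c + 0 ^ 2))
        + 7 / 36 * ((1 - (4 / 5 : ℝ) ^ 2) / (1 - 2 * (4 / 5) * c + (4 / 5) ^ 2))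
      ≤ (1 - (1 / 3 : ℝ) ^ 2) / (1 - 2 * (1 / 3) * c + (1 / 3) ^ 2) := by
  have hA : 0 < 41 - 40 * c := by linarith
  have hB : 0 < 10 - 6 * c := by linarith
  have hd₁ : (1 : ℝ) - 2 * (1 / 3) * c + (1 / 3) ^ 2 ≠ 0 := by nlinarith
  have hd₂ : (1 : ℝ) - 2 * (4 / 5) * c + (4 / 5) ^ 2 ≠ 0 := by nlinarith
  have h0 : (1 - (0 : ℝ) ^ 2) / (1 - 2 * 0 * c + 0 ^ 2) = 1 := by norm_num
  have h1 : (1 - (1 / 3 : ℝ) ^ 2) / (1 - 2 * (1 / 3) * c + (1 / 3) ^ 2) = 8 / (10 - 6 * c) := by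
    rw [div_eq_div_iff hd₁ hB.ne']; ring
  have h2 : (1 - (4 / 5 : ℝ) ^ 2) / (1 - 2 * (4 / 5) * c + (4 / 5) ^ 2) = 9 / (41 - 40 * c) := by
    rw [div_eq_div_iff hd₂ hA.ne']; ring
  rw [h0, h1, h2, le_div_iff₀ hB]
  set t : ℝ := 9 / (41 - 40 * c) with ht_def
  have ht : t * (41 - 40 * c) = 9 := div_mul_cancel₀ _ hA.ne'
  have ht0 : 0 ≤ t := div_nonneg (by norm_num) hA.le
  have key : 0 ≤ t * ((1 - c) * (52 + 15 * c)) :=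
    mul_nonneg ht0 (mul_nonneg (by linarith) (by linarith))
  have hid : (8 : ℝ) - (1 / 4 * 1 + 7 / 36 * t) * (10 - 6 * c) = 4 / 9 * (t * ((1 - c) * (52 + 15 * c))) := by
    linear_combination (-(11 + 3 * c) / 18) * ht
  nlinarith [key, hid]

/-! ### The three-point inequality -/

/-- The Cayley map `w ↦ (1 + w)/(1 − w)` sends the open unit disc into the right half-plane.
[folklore] -/
private theorem re_cayley_pos {w : ℂ} (hw : ‖w‖ < 1) : 0 < ((1 + w) / (1 - w)).re := by
  have h1 : 1 - w ≠ 0 := by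
    intro h
    have : ‖w‖ = 1 := by rw [sub_eq_zero] at h; rw [← h]; simp
    linarith
  have hns : 0 < normSq (1 - w) := normSq_pos.2 h1
  have hw2 : w.re ^ 2 + w.im ^ 2 < 1 := by
    have h : ‖w‖ ^ 2 < 1 := by nlinarith [norm_nonneg w]
    rw [Complex.sq_norm, normSq_apply] at h
    nlinarith
  rw [div_re, ← add_div]
  refine div_pos ?_ hns
  simp only [add_re, one_re, sub_re, add_im, one_im, sub_im, zero_add, zero_sub]
  nlinarith

/-- **Three-point Harnack inequality on the right half-plane.**  Every non-negative harmonic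
function `v` on `{Re z > 0}` satisfies `v(1)/4 + 7·v(9)/36 ≤ v(2)` (sharp: equality for
`v = Re z`).  Cayley pull-back to the disc (`1, 2, 9 ↦ 0, 1/3, 4/5`), Herglotz–Riesz representation
`v ∘ ψ = ∫ P(·, ζ) dν(ζ)` (tree `exists_measure_eq_integral_poissonKernel`), and the pointwise
kernel certificate `poisson_threePoint_certificate` integrated against `ν ≥ 0`. [folklore] -/
theorem three_point_harnack_halfPlane {v : ℂ → ℝ} (hv : HarmonicOnNhd v {z : ℂ | 0 < z.re})
    (hv0 : ∀ z : ℂ, 0 < z.re → 0 ≤ v z) :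
    v 1 / 4 + 7 / 36 * v 9 ≤ v 2 := by
  -- the Cayley map of the disc onto the right half-plane with `ψ 0 = 1`
  set ψ : ℂ → ℂ := fun w ↦ (1 + w) / (1 - w) with hψ
  have hne : ∀ w ∈ ball (0 : ℂ) 1, (1 : ℂ) - w ≠ 0 := by
    intro w hw h
    rw [mem_ball_zero_iff] at hw
    rw [sub_eq_zero] at h
    rw [← h] at hw
    simp at hw
  have hψd : DifferentiableOn ℂ ψ (ball 0 1) := by
    intro w hw
    exact (((differentiableAt_const _).add differentiableAt_id).div
      ((differentiableAt_const _).sub differentiableAt_id) (hne w hw)).differentiableWithinAt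
  have hψre : ∀ w ∈ ball (0 : ℂ) 1, 0 < (ψ w).re := fun w hw ↦
    re_cayley_pos (mem_ball_zero_iff.1 hw)
  have hmaps : MapsTo ψ (ball 0 1) {z : ℂ | 0 < z.re} := fun w hw ↦ hψre w hw
  have hopen : IsOpen {z : ℂ | 0 < z.re} := isOpen_lt continuous_const Complex.continuous_re
  -- `u = v ∘ ψ` is harmonic and non-negative on the disc, hence a Poisson integral
  have hu : HarmonicOnNhd (fun w ↦ v (ψ w)) (ball 0 1) :=
    Literature.Analysis.Complex.harmonicOnNhd_comp_of_differentiableOn hv hopen hψd isOpen_ball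
      hmaps
  have hu0 : ∀ w ∈ ball (0 : ℂ) 1, 0 ≤ v (ψ w) := fun w hw ↦ hv0 _ (hψre w hw)
  obtain ⟨ν, hν, hrep⟩ := exists_measure_eq_integral_poissonKernel hu hu0
  -- the three points
  have hb0 : ((0 : ℝ) : ℂ) ∈ ball (0 : ℂ) 1 := by simp
  have hb1 : ((1 / 3 : ℝ) : ℂ) ∈ ball (0 : ℂ) 1 := by
    rw [mem_ball_zero_iff, norm_real, Real.norm_eq_abs]; norm_num
  have hb2 : ((4 / 5 : ℝ) : ℂ) ∈ ball (0 : ℂ) 1 := by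
    rw [mem_ball_zero_iff, norm_real, Real.norm_eq_abs]; norm_num
  have hψ0 : ψ ((0 : ℝ) : ℂ) = 1 := by simp [hψ]
  have hψ1 : ψ ((1 / 3 : ℝ) : ℂ) = 2 := by
    simp only [hψ]; push_cast; norm_num
  have hψ2 : ψ ((4 / 5 : ℝ) : ℂ) = 9 := by
    simp only [hψ]; push_cast; norm_num
  have e0 : v 1 = ∫ ζ : sphere (0 : ℂ) 1, poissonKernel 0 ((0 : ℝ) : ℂ) ζ ∂ν := by
    rw [← hψ0]; exact hrep _ hb0
  have e1 : v 2 = ∫ ζ : sphere (0 : ℂ) 1, poissonKernel 0 ((1 / 3 : ℝ) : ℂ) ζ ∂ν := by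
    rw [← hψ1]; exact hrep _ hb1
  have e2 : v 9 = ∫ ζ : sphere (0 : ℂ) 1, poissonKernel 0 ((4 / 5 : ℝ) : ℂ) ζ ∂ν := by
    rw [← hψ2]; exact hrep _ hb2
  -- integrability of the three kernels on the circle
  haveI := hν
  have hint : ∀ {w : ℂ}, w ∈ ball (0 : ℂ) 1 →
      Integrable (fun ζ : sphere (0 : ℂ) 1 => poissonKernel 0 w ζ) ν := fun hw ↦
    (continuous_poissonKernel_sphere (mem_ball_zero_iff.1 hw)).integrable_of_hasCompactSupport
      (HasCompactSupport.of_compactSpace _)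
  -- the pointwise certificate on the circle
  have hpt : ∀ ζ : sphere (0 : ℂ) 1,
      0 ≤ poissonKernel 0 ((1 / 3 : ℝ) : ℂ) ζ - (1 / 4 * poissonKernel 0 ((0 : ℝ) : ℂ) ζ
        + 7 / 36 * poissonKernel 0 ((4 / 5 : ℝ) : ℂ) ζ) := by
    intro ζ
    have hζ : ‖(ζ : ℂ)‖ = 1 := mem_sphere_zero_iff_norm.1 ζ.2
    have hc := abs_le.1 (abs_re_le_one_of_norm_eq_one hζ)
    rw [poissonKernel_zero_ofReal hζ, poissonKernel_zero_ofReal hζ, poissonKernel_zero_ofReal hζ,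
      sub_nonneg]
    exact poisson_threePoint_certificate hc.2 hc.1
  -- integrate
  have hI : 0 ≤ ∫ ζ : sphere (0 : ℂ) 1, (poissonKernel 0 ((1 / 3 : ℝ) : ℂ) ζ
      - (1 / 4 * poissonKernel 0 ((0 : ℝ) : ℂ) ζ + 7 / 36 * poissonKernel 0 ((4 / 5 : ℝ) : ℂ) ζ)) ∂ν :=
    integral_nonneg fun ζ => hpt ζ
  have hg0 : Integrable (fun ζ : sphere (0 : ℂ) 1 => 1 / 4 * poissonKernel 0 ((0 : ℝ) : ℂ) ζ) ν :=
    (hint hb0).const_mul _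
  have hg2 : Integrable (fun ζ : sphere (0 : ℂ) 1 => 7 / 36 * poissonKernel 0 ((4 / 5 : ℝ) : ℂ) ζ) ν :=
    (hint hb2).const_mul _
  have hg : Integrable (fun ζ : sphere (0 : ℂ) 1 => 1 / 4 * poissonKernel 0 ((0 : ℝ) : ℂ) ζ
      + 7 / 36 * poissonKernel 0 ((4 / 5 : ℝ) : ℂ) ζ) ν := hg0.add hg2
  rw [integral_sub (hint hb1) hg, integral_add hg0 hg2, integral_const_mul, integral_const_mul,
    ← e0, ← e1, ← e2] at hI
  linarith

/-! ### Separation: both chord laws do not imply Harnack-cone membership -/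

/-- **`max 1 (x/2)` is not in the Harnack hull.**  There is no family `G i` of functions
harmonic and non-negative on `{Re z > 0}` whose traces majorise `g(x) = max 1 (x/2)` on `[1, ∞)`
and touch it to every accuracy at every point — although `g(x)/x` is non-increasing and `x·g(x)`
non-decreasing (both sharp chord laws).  Indeed `three_point_harnack_halfPlane` gives
`G i 2 ≥ G i 1 / 4 + 7 G i 9 / 36 ≥ 1/4 + 7/8 = 9/8` for every `i`, while touching at `x = 2`
would need some `G i 2 ≤ 1 + 1/16`. [folklore] -/
theorem not_harnackHull_max_one_half :
    ¬ ∃ (ι : Type) (G : ι → ℂ → ℝ),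
      (∀ i, HarmonicOnNhd (G i) {z : ℂ | 0 < z.re}) ∧
      (∀ i (z : ℂ), 0 < z.re → 0 ≤ G i z) ∧
      (∀ x : ℝ, 1 ≤ x → ∀ i, max 1 (x / 2) ≤ G i x) ∧
      (∀ x : ℝ, 1 ≤ x → ∀ ε : ℝ, 0 < ε → ∃ i, G i x ≤ max 1 (x / 2) + ε) := by
  rintro ⟨ι, G, hh, h0, hge, hle⟩
  obtain ⟨i, hi⟩ := hle 2 (by norm_num) (1 / 16) (by norm_num)
  have h3 := three_point_harnack_halfPlane (hh i) (h0 i)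
  have h1 := hge 1 le_rfl i
  have h9 := hge 9 (by norm_num) i
  have e1 : ((1 : ℝ) : ℂ) = 1 := by norm_num
  have e2 : ((2 : ℝ) : ℂ) = 2 := by norm_num
  have e9 : ((9 : ℝ) : ℂ) = 9 := by norm_num
  rw [e1] at h1
  rw [e2] at hi
  rw [e9] at h9
  have m1 : max (1 : ℝ) (1 / 2) = 1 := by norm_num
  have m2 : max (1 : ℝ) (2 / 2) = 1 := by norm_num
  have m9 : max (1 : ℝ) (9 / 2) = 9 / 2 := by norm_num
  rw [m1] at h1
  rw [m2] at hi
  rw [m9] at h9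
  linarith

end Literature.Analysis.Complex

end
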